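import Mathlib
import Literature.LinearAlgebra.Matrix.GerstenhaberNilpotentSubspace
import Summits.ValiantsHypothesis.ValiantsHypothesis.Theorems.GrenetZeonTwoDimCoefficientsPermanentHessianFlat
import Summits.ValiantsHypothesis.ValiantsHypothesis.Theorems.GrenetZeonTwoDimCoefficientsDualUnipotentGerstenhaber

/-!
# Linear spaces of matrices on which all polarised `2 × 2` permanents vanish have dimension `≤ n`

Crux `GrenetZeon.TwoDimCoefficients` (stmt-ValiantsHypothesis-8062), line `dim2_cases`, stub
`stub_dualUnipotent` — sharpening of the flatness lemma `finrank_le_of_hess0_perPoly_isOrtho`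
(`dim ≤ 2n`, `…PermanentHessianFlat.lean`) to the tight `dim ≤ n` (a row attains it).

**Theorem (`finrank_le_of_polarized_perm_two`).** Let `K` be a linear subspace of `n × n` matrices
over a field such that for all `u, v ∈ K` and all rows `i ≠ j`, columns `a ≠ b`,
`u_{ia} v_{jb} + u_{jb} v_{ia} + u_{ib} v_{ja} + u_{ja} v_{ib} = 0` (all polarised `2 × 2`
sub-permanents vanish on `K`).  Then `dim K ≤ n`.

Proof.  Pick `w ∈ K` with `w_{i₀a₀} ≠ 0` and let `K₀ = {v ∈ K : row i₀ of v = 0}`.  Testing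
`v ∈ K₀` against `w` on rows `{i₀, j}`, columns `{a₀, b}` gives `w_{i₀a₀} v_{jb} = −w_{i₀b} v_{ja₀}`,
so `v ↦ (column a₀ of v)` is injective on `K₀`, with image in the hyperplane `c_{i₀} = 0`:
`dim K₀ ≤ n − 1`.  If `K₀ = 0`, the row-`i₀` map is injective and `dim K ≤ n`.  Otherwise pick
`v₀ ∈ K₀` with `v₀_{j₁a₀} ≠ 0`; testing `v ∈ K` against `v₀` on rows `{i₀, j₁}`, columns `{a₀, b}`
gives `v₀_{j₁a₀} v_{i₀b} = −v₀_{j₁b} v_{i₀a₀}`, so `v_{i₀a₀} = 0` forces `v ∈ K₀`: `dim K ≤ 1 + dim K₀ ≤ n`.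

**Corollaries.** The Hessian of `per_n` at a permutation matrix with two columns zeroed IS such a
polarised `2 × 2` permanent (`toBilin_hess0_perPoly_testPoint`, `…PermanentHessianFlat.lean`), so
`finrank_le_of_hess0_perPoly_isOrtho_sharp`: second-order flats of the permanent have `dim ≤ n`
(the tree's `finrank_le_of_hess0_perPoly_isOrtho` gave `2n`).  With Gerstenhaber's theorem
(`Literature…GerstenhaberNilpotentSubspace`, as in `…DualUnipotentGerstenhaber.lean`):
`choose_two_bound_of_dualUnipotentRepr` — `DualUnipotentRepr n m`, `n ≥ 3` ⟹
`n² ≤ binom(m,2) + n`, i.e. `2n(n−1) ≤ m(m−1)` (`two_mul_mul_pred_le_of_dualUnipotentRepr`);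
small cases `not_dualUnipotentRepr_four_five` (the unipotent-trace width of `per_4` is `≥ 6`),
`not_dualUnipotentRepr_five_six` (`per_5`: `≥ 7`).  At `n = 3` the bound is `binom(m,2) ≥ 6`, i.e.
`m ≥ 4` with EQUALITY allowed at `m = 4` — excluding `m = 4` needs the equality case of
Gerstenhaber's theorem (not in the tree; see `Cruxes/TwoDimCoefficients/WIDTH-per3-falsifier.md`).

HONEST FRAMING: an elementary lemma serving constant-factor calibrations of an open-problem-grade
stub; `VP ≠ VNP` is not moved by anything here.
-/

set_option linter.dupNamespace false

noncomputable section

namespace Summit.ValiantsHypothesis.ValiantsHypothesis.Cruxes.TwoDimCoefficients.DimTwoCases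

open Matrix

section PolarizedPermTwo

variable {F : Type*} [Field F] {n : ℕ}

/-- **Linear spaces killed by all polarised `2 × 2` permanents are at most `n`-dimensional.**
If `u_{ia} v_{jb} + u_{jb} v_{ia} + u_{ib} v_{ja} + u_{ja} v_{ib} = 0` for all `u, v` in a subspace
`K` of `n × n` matrices and all `i ≠ j`, `a ≠ b`, then `dim K ≤ n` (tight: a row). [folklore] -/
theorem finrank_le_of_polarized_perm_two (K : Submodule F (Fin n × Fin n → F))
    (hK : ∀ u ∈ K, ∀ v ∈ K, ∀ i j a b : Fin n, i ≠ j → a ≠ b →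
      u (i, a) * v (j, b) + u (j, b) * v (i, a) + u (i, b) * v (j, a) + u (j, a) * v (i, b) = 0) :
    Module.finrank F K ≤ n := by
  classical
  by_cases hbot : K = ⊥
  · rw [hbot, finrank_bot]; exact Nat.zero_le _
  obtain ⟨w, hwK, hw0⟩ := (Submodule.ne_bot_iff K).mp hbot
  obtain ⟨⟨i₀, a₀⟩, hw⟩ := Function.ne_iff.mp hw0
  -- row `i₀` and column `a₀` as linear maps on `K`
  obtain ⟨ρ, hρ⟩ : ∃ ρ : K →ₗ[F] (Fin n → F), ∀ v b, ρ v b = (v : Fin n × Fin n → F) (i₀, b) :=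
    ⟨(LinearMap.pi fun b => LinearMap.proj (i₀, b)) ∘ₗ K.subtype, fun v b => rfl⟩
  -- Fact A/B: on the elements of `K` with zero row `i₀`, column `a₀` determines everything
  have hA : ∀ v ∈ K, (∀ c, v (i₀, c) = 0) → ∀ j b, j ≠ i₀ → b ≠ a₀ →
      w (i₀, a₀) * v (j, b) = -(w (i₀, b) * v (j, a₀)) := by
    intro v hv hrow j b hj hb
    have h := hK w hwK v hv i₀ j a₀ b hj.symm hb.symm
    rw [hrow a₀, hrow b, mul_zero, mul_zero, add_zero, add_zero] at h
    exact eq_neg_of_add_eq_zero_left h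
  have hB : ∀ v ∈ K, (∀ c, v (i₀, c) = 0) → (∀ j, v (j, a₀) = 0) → v = 0 := by
    intro v hv hrow hcol
    funext ⟨j, b⟩
    by_cases hj : j = i₀
    · subst hj; exact hrow b
    by_cases hb : b = a₀
    · subst hb; exact hcol j
    have h := hA v hv hrow j b hj hb
    rw [hcol j, mul_zero, neg_zero] at h
    exact (mul_eq_zero.1 h).resolve_left hw
  have hkerrow : ∀ v : K, ρ v = 0 → ∀ c, (v : Fin n × Fin n → F) (i₀, c) = 0 := fun v hv c => by
    have := congrFun hv c; rwa [hρ] at this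
  -- `dim ker ρ ≤ n - 1`: column `a₀` embeds it into the hyperplane `c i₀ = 0`
  obtain ⟨γ, hγ⟩ : ∃ γ : LinearMap.ker ρ →ₗ[F] (Fin n → F),
      ∀ v j, γ v j = ((v : K) : Fin n × Fin n → F) (j, a₀) :=
    ⟨(LinearMap.pi fun j => LinearMap.proj (j, a₀)) ∘ₗ K.subtype ∘ₗ (LinearMap.ker ρ).subtype,
      fun v j => rfl⟩
  have hγinj : Function.Injective γ := by
    intro v v' h
    have hd : ((v : K) : Fin n × Fin n → F) - ((v' : K) : Fin n × Fin n → F) = 0 := by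
      refine hB _ (K.sub_mem (v : K).2 (v' : K).2) (fun c => ?_) (fun j => ?_)
      · rw [Pi.sub_apply, hkerrow _ (LinearMap.mem_ker.1 v.2), hkerrow _ (LinearMap.mem_ker.1 v'.2),
          sub_zero]
      · have := congrFun h j
        rw [hγ, hγ] at this
        rw [Pi.sub_apply, this, sub_self]
    exact Subtype.ext (Subtype.ext (sub_eq_zero.1 hd))
  have hγle : LinearMap.range γ ≤ LinearMap.ker (LinearMap.proj i₀ : (Fin n → F) →ₗ[F] F) := by
    rintro c ⟨v, rfl⟩
    rw [LinearMap.mem_ker, LinearMap.proj_apply, hγ]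
    exact hkerrow _ (LinearMap.mem_ker.1 v.2) a₀
  have hhyp : Module.finrank F (LinearMap.ker (LinearMap.proj i₀ : (Fin n → F) →ₗ[F] F)) = n - 1 := by
    have hsurj : LinearMap.range (LinearMap.proj i₀ : (Fin n → F) →ₗ[F] F) = ⊤ := by
      rw [LinearMap.range_eq_top]
      intro c
      exact ⟨Pi.single i₀ c, by simp⟩
    have h := LinearMap.finrank_range_add_finrank_ker (LinearMap.proj i₀ : (Fin n → F) →ₗ[F] F)
    rw [hsurj, finrank_top, Module.finrank_self, Module.finrank_fintype_fun_eq_card,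
      Fintype.card_fin] at h
    omega
  have hkerρ : Module.finrank F (LinearMap.ker ρ) ≤ n - 1 := by
    rw [← LinearMap.finrank_range_of_inj hγinj, ← hhyp]
    exact Submodule.finrank_mono hγle
  have hsum := LinearMap.finrank_range_add_finrank_ker ρ
  have hn : 1 ≤ n := by
    rcases n with _ | n
    · exact i₀.elim0
    · exact Nat.succ_le_succ (Nat.zero_le _)
  by_cases hker0 : LinearMap.ker ρ = ⊥
  · -- the row-`i₀` map is injective
    have hr : Module.finrank F (LinearMap.range ρ) ≤ n := by
      calc Module.finrank F (LinearMap.range ρ) ≤ Module.finrank F (Fin n → F) :=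
            Submodule.finrank_le _
        _ = n := by rw [Module.finrank_fintype_fun_eq_card, Fintype.card_fin]
    rw [hker0, finrank_bot] at hsum
    omega
  · -- some `v₀ ∈ ker ρ` with `v₀ (j₁, a₀) ≠ 0`; then row `i₀` of every `v ∈ K` is a multiple
    -- of a fixed vector, so `dim range ρ ≤ 1`
    obtain ⟨v₀, hv₀K, hv₀0⟩ := (Submodule.ne_bot_iff _).mp hker0
    have hv₀ρ : ρ v₀ = 0 := LinearMap.mem_ker.1 hv₀K
    obtain ⟨j₁, hj₁⟩ : ∃ j₁, ((v₀ : K) : Fin n × Fin n → F) (j₁, a₀) ≠ 0 := by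
      by_contra hnone
      push Not at hnone
      exact hv₀0 (Subtype.ext (hB _ v₀.2 (hkerrow v₀ hv₀ρ) hnone))
    have hj₁i : j₁ ≠ i₀ := by
      intro h
      apply hj₁
      rw [h]
      exact hkerrow v₀ hv₀ρ a₀
    -- Fact C
    have hC : ∀ v : K, ∀ b, b ≠ a₀ →
        ((v₀ : K) : Fin n × Fin n → F) (j₁, a₀) * (v : Fin n × Fin n → F) (i₀, b) =
          -(((v₀ : K) : Fin n × Fin n → F) (j₁, b) * (v : Fin n × Fin n → F) (i₀, a₀)) := by
      intro v b hb
      have hrow : ∀ c, ((v₀ : K) : Fin n × Fin n → F) (i₀, c) = 0 := hkerrow v₀ hv₀ρ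
      have h := hK v v.2 (v₀ : K) (v₀ : K).2 i₀ j₁ a₀ b hj₁i.symm hb.symm
      rw [hrow a₀, hrow b, mul_zero, mul_zero, add_zero] at h
      -- h : v(i₀,a₀) v₀(j₁,b) + v(i₀,b) v₀(j₁,a₀) = 0
      linear_combination h
    set r : Fin n → F := fun b =>
      if b = a₀ then 1 else -(((v₀ : K) : Fin n × Fin n → F) (j₁, b) /
        ((v₀ : K) : Fin n × Fin n → F) (j₁, a₀)) with hr
    have hrange : LinearMap.range ρ ≤ F ∙ r := by
      rintro c ⟨v, rfl⟩
      rw [Submodule.mem_span_singleton]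
      refine ⟨(v : Fin n × Fin n → F) (i₀, a₀), ?_⟩
      funext b
      rw [Pi.smul_apply, hρ, hr, smul_eq_mul]
      dsimp only
      by_cases hb : b = a₀
      · rw [if_pos hb, hb, mul_one]
      · rw [if_neg hb]
        have h := hC v b hb
        symm
        calc (v : Fin n × Fin n → F) (i₀, b)
            = ((v₀ : K) : Fin n × Fin n → F) (j₁, a₀) * (v : Fin n × Fin n → F) (i₀, b) /
                ((v₀ : K) : Fin n × Fin n → F) (j₁, a₀) := by rw [mul_div_cancel_left₀ _ hj₁]
          _ = -(((v₀ : K) : Fin n × Fin n → F) (j₁, b) * (v : Fin n × Fin n → F) (i₀, a₀)) /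
                ((v₀ : K) : Fin n × Fin n → F) (j₁, a₀) := by rw [h]
          _ = _ := by ring
    have hr1 : Module.finrank F (LinearMap.range ρ) ≤ 1 :=
      (Submodule.finrank_mono hrange).trans ((finrank_span_le_card ({r} : Set (Fin n → F))).trans
        (by simp))
    omega

end PolarizedPermTwo


/-! ### Second-order flats of the permanent have `dim ≤ n`; Gerstenhaber ⟹ `2n(n−1) ≤ m(m−1)` -/

section Assembly

open MvPolynomial
open Literature.Computability.AlgebraicComplexity
open Literature.LinearAlgebra.Matrix.GerstenhaberNilpotentSubspace

/-- A permutation of `Fin n` taking `a ↦ i` and `b ↦ j` (`a ≠ b`, `i ≠ j`). [folklore] -/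
theorem exists_perm_apply_eq_apply_eq {n : ℕ} {i j a b : Fin n} (hij : i ≠ j) (hab : a ≠ b) :
    ∃ τ : Equiv.Perm (Fin n), τ a = i ∧ τ b = j := by
  classical
  set c := Equiv.swap i a b with hc
  have hci : c ≠ i := by
    intro h
    rw [hc, Equiv.swap_apply_eq_iff, Equiv.swap_apply_left] at h
    exact hab h.symm
  refine ⟨Equiv.swap j c * Equiv.swap i a, ?_, ?_⟩
  · rw [Equiv.Perm.mul_apply, Equiv.swap_apply_right]
    exact Equiv.swap_apply_of_ne_of_ne hij hci.symm
  · rw [Equiv.Perm.mul_apply, ← hc, Equiv.swap_apply_right]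

/-- **Second-order flats of the permanent have `dim ≤ n` (sharp).** If a linear subspace `K` of
`n × n` matrices is totally isotropic for the Hessian of `per_n` at EVERY point (equivalently,
`per_n` is affine along every coset of `K`), then `dim K ≤ n`; a row attains the bound.  Sharpens
the tree's `finrank_le_of_hess0_perPoly_isOrtho` (`dim K ≤ 2n`). [folklore] -/
theorem finrank_le_of_hess0_perPoly_isOrtho_sharp {n : ℕ} (K : Submodule ℂ (Fin n × Fin n → ℂ))
    (hK : ∀ p : Fin n × Fin n → ℂ, ∀ u ∈ K, ∀ v ∈ K,
      Matrix.toBilin' (hess0 (transl p (perPoly (Fin n) ℂ))) u v = 0) :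
    Module.finrank ℂ K ≤ n := by
  classical
  refine finrank_le_of_polarized_perm_two K fun u hu v hv i j a b hij hab => ?_
  obtain ⟨τ, hτa, hτb⟩ := exists_perm_apply_eq_apply_eq hij hab
  have key := toBilin_hess0_perPoly_testPoint τ hab u v
  rw [hK _ u hu v hv, hτa, hτb] at key
  linear_combination -key

/-- **Gerstenhaber + sharp flats in the unipotent-trace model.** If `per_n` (`n ≥ 3`) has a
unipotent dual representation of size `m`, then `n² ≤ binom(m,2) + n`: in the normal form
`per_n = tr(N^{n−1}M)` the values of the nilpotent pencil span a nilpotent space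
(`dim ≤ binom(m,2)`) whose common kernel is a second-order flat of `per_n` (`dim ≤ n`).
[folklore] -/
theorem choose_two_bound_of_dualUnipotentRepr {n m : ℕ} (hn : 3 ≤ n)
    (h : DualUnipotentRepr n m) : n ^ 2 ≤ m.choose 2 + n := by
  obtain ⟨N, M, hN, hM, hNil, hper⟩ := exists_nilpotent_pencil_of_dualUnipotentRepr (by omega) h
  let D : (Fin n × Fin n → ℂ) → Derivation ℂ (MvPolynomial (Fin n × Fin n) ℂ)
      (MvPolynomial (Fin n × Fin n) ℂ) := fun u => ∑ s, u s • (pderiv s : Derivation ℂ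
        (MvPolynomial (Fin n × Fin n) ℂ) (MvPolynomial (Fin n × Fin n) ℂ))
  have hDadd : ∀ u v, D (u + v) = D u + D v := fun u v => by
    simp only [D, Pi.add_apply, add_smul, Finset.sum_add_distrib]
  have hDsmul : ∀ (c : ℂ) u, D (c • u) = c • D u := fun c u => by
    simp only [D, Pi.smul_apply, smul_eq_mul, mul_smul, Finset.smul_sum]
  let Φ : (Fin n × Fin n → ℂ) →ₗ[ℂ] Matrix (Fin m) (Fin m) ℂ :=
    { toFun := fun u => N.map fun f => constantCoeff (D u f)
      map_add' := fun u v => by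
        ext i j
        simp only [Matrix.map_apply, Matrix.add_apply, hDadd, Derivation.add_apply, map_add]
      map_smul' := fun c u => by
        ext i j
        simp only [Matrix.map_apply, Matrix.smul_apply, hDsmul, Derivation.smul_apply,
          RingHom.id_apply, smul_eq_mul, constantCoeff_smul] }
  have hΦ : ∀ u, Φ u = N.map fun f => constantCoeff (D u f) := fun u => rfl
  have hD0 : ∀ u (f : MvPolynomial (Fin n × Fin n) ℂ), f.IsHomogeneous 1 →
      (D u f).IsHomogeneous 0 := fun u f hf => isHomogeneous_zero_sum_smul_pderiv u hf
  have hΦeval : ∀ u, Φ u = N.map (eval u) := by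
    intro u
    rw [hΦ]
    ext i j
    rw [Matrix.map_apply, Matrix.map_apply]
    exact constantCoeff_sum_smul_pderiv_eq_eval u (hN i j)
  have hrange : Module.finrank ℂ (LinearMap.range Φ) ≤ m.choose 2 := by
    refine finrank_le_choose_two m _ ?_
    rintro B ⟨u, rfl⟩
    refine ⟨m, ?_⟩
    rw [hΦeval, ← RingHom.mapMatrix_apply, ← map_pow, hNil, map_zero]
  have hflat : ∀ p : Fin n × Fin n → ℂ, ∀ u ∈ LinearMap.ker Φ, ∀ v ∈ LinearMap.ker Φ,
      Matrix.toBilin' (hess0 (transl p (perPoly (Fin n) ℂ))) u v = 0 := by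
    intro p u hu v hv
    have hu' : N.map (D u) = 0 := by
      rw [map_derivation_eq_map_C (D u) (hD0 u) hN, ← hΦ, LinearMap.mem_ker.1 hu]
      exact Matrix.map_zero _ (map_zero (algebraMap ℂ (MvPolynomial (Fin n × Fin n) ℂ)))
    have hv' : N.map (D v) = 0 := by
      rw [map_derivation_eq_map_C (D v) (hD0 v) hN, ← hΦ, LinearMap.mem_ker.1 hv]
      exact Matrix.map_zero _ (map_zero (algebraMap ℂ (MvPolynomial (Fin n × Fin n) ℂ)))
    rw [toBilin'_hess0_transl_eq_eval p u v (perPoly (Fin n) ℂ), hper,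
      derivation_derivation_trace_pow_mul hM (n - 1) (D v) (D u) (hD0 v) hv' hu', map_zero]
  have hker : Module.finrank ℂ (LinearMap.ker Φ) ≤ n :=
    finrank_le_of_hess0_perPoly_isOrtho_sharp _ hflat
  have hsum : Module.finrank ℂ (LinearMap.range Φ) + Module.finrank ℂ (LinearMap.ker Φ) = n ^ 2 := by
    rw [LinearMap.finrank_range_add_finrank_ker Φ, Module.finrank_fintype_fun_eq_card,
      Fintype.card_prod, Fintype.card_fin, sq]
  omega

/-- **Packaged form:** `DualUnipotentRepr n m`, `n ≥ 3` ⟹ `2n(n−1) ≤ m(m−1)` (`m ≳ √2·n + ½`).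
[folklore] -/
theorem two_mul_mul_pred_le_of_dualUnipotentRepr {n m : ℕ} (hn : 3 ≤ n)
    (h : DualUnipotentRepr n m) : 2 * (n * (n - 1)) ≤ m * (m - 1) := by
  have h1 := choose_two_bound_of_dualUnipotentRepr hn h
  have h2 : m.choose 2 = m * (m - 1) / 2 := Nat.choose_two_right m
  have h3 : m * (m - 1) / 2 * 2 ≤ m * (m - 1) := Nat.div_mul_le_self _ _
  obtain ⟨k, rfl⟩ : ∃ k, n = k + 3 := ⟨n - 3, by omega⟩
  have h4 : k + 3 - 1 = k + 2 := by omega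
  have h5 : (k + 3) ^ 2 = (k + 3) * (k + 2) + (k + 3) := by ring
  rw [h4]
  omega

/-- **The permanent of order `4` has no unipotent dual representation of size `5`**
(`16 ≤ binom(5,2) + 4 = 14` fails): with `not_dualUnipotentRepr_four_four`, the unipotent-trace
width of `per_4` is `≥ 6`. [folklore] -/
theorem not_dualUnipotentRepr_four_five : ¬ DualUnipotentRepr 4 5 := by
  intro h
  have := choose_two_bound_of_dualUnipotentRepr (by norm_num) h
  simp [Nat.choose] at this

/-- **The permanent of order `5` has no unipotent dual representation of size `6`**
(`25 ≤ binom(6,2) + 5 = 20` fails): the unipotent-trace width of `per_5` is `≥ 7`. [folklore] -/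
theorem not_dualUnipotentRepr_five_six : ¬ DualUnipotentRepr 5 6 := by
  intro h
  have := choose_two_bound_of_dualUnipotentRepr (by norm_num) h
  simp [Nat.choose] at this

end Assembly

end Summit.ValiantsHypothesis.ValiantsHypothesis.Cruxes.TwoDimCoefficients.DimTwoCases

end
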